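import Literature.NumberTheory.EllipticCurves.HalfIntegralWeightGaussSumsOdd
import Literature.NumberTheory.EllipticCurves.ShintaniGenusSymbols
import Mathlib.NumberTheory.JacobiSum.Basic
import HarnessLib

/-!
# Cone Gauss sums: the twisted Gauss sums of the level-`64` Shintani kernel

The finite (arithmetic) input of the level-`256` transformation law of the genus-character-twisted
Shintani theta kernels `K_D(w, z) = (Im z)^{1/2} ∑_{v ∈ ℤ³} ω_D(v) f_{w, z/(256D)}(ι(v))`
(`ω_D = genusWt D` of `ShintaniGenusSymbols`; route towards Waldspurger's relation for Tunnell's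
theorem, see `ShintaniSchwartzFourier`): after Poisson summation over the residue classes of `ℤ³`
modulo `N = 256D`, the law for `γ = (a b; 256 d)` comes down to the **cone Gauss sum**

  `(★G)  ∑_{r ∈ (ℤ/N)³} ω_D(r - u) e_N(a · n(r)) = ω_D(-u) · N · G(64a; N)`

(`n(r) = 64r₁² - r₀r₂`, `G(a; c) = ModularForms.quadGaussSum c a 0`, `a` a unit mod `N`, `u ∈ (ℤ/N)³`),
PROVED here as `coneSum_wN`, together with the bridge `genusWt_eq_wN` to the integer weight. By the
Chinese remainder theorem (`coneSum_mul_of_coprime`) it factors into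

* the `2`-adic sum (`coneSum_χ₄`): `∑_{r mod 256} χ₋₄(r₂ - u₂) e(t n(r)/256) = χ₋₄(-u₂)·256·G(64t;256)`
  (the `r₀`-sum forces `r₂ = 0`), and
* the `D`-part (`dPartProp_all`, induction over the square-free `D`), whose prime case is the heart
  of the file: **the cone symbol `Ω_p` is an eigenvector of the finite Fourier (Weil) operator of
  the quadratic form `n`** (`sum_coneSymF_sub_mul_ψ`):
  `∑_{ρ ∈ 𝔽_p³} Ω_p(ρ - μ) e_p(t n(ρ)) = Ω_p(-μ) · p · G(64t; p)`.
  Proof: shift `ρ = κ + μ` and use `n(κ) = 0` on the support (the cone); parametrise the nonzero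
  cone vectors as `λ(X + βY)²`, `λY²` with symbol `χ(λ)` (`sum_coneSymF_mul`); the `λ`-sums are
  Gauss sums `∑ χ(λ)e(λc) = χ(c) g` (`sum_χc_mul_ψ`); what is left is the sum of `χ` over the values of
  the form `μ` at the `p+1` points of `P¹(𝔽_p)`, which is `p Ω_p(μ)` (`sum_χc_binValF`: `0` for
  nondegenerate `μ` by the evaluation of complete character sums of quadratic polynomials
  `sum_χc_quadratic`, a Jacobi sum; `p χ(λ)` on the cone).

Also proved, as the two consequences actually fed into the level-`256` law: off the sublattice `L`
(`128 ∤ k₁`) the Gauss coefficient sum `∑_r ω_D(r) ψ_N(a n(r) + ℓ(r,k))` VANISHES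
(`sum_wN_mul_stdAddChar_eq_zero`, by the shift `r₁ ↦ r₁ + 2D`), and on `L` it is the cone Gauss sum
after completing the square (`sum_wN_mul_stdAddChar_bZ`); and the scaling of the weight by integers,
`ω_D(tv) = χ₄(t) J(t|D) ω_D(v)` (`genusWt_smul`, `coneSym_smul`).

No named facts are introduced (D-0026); definitions: `χc`, `ψp`, `gq` (abbreviations), `nF`, `bF`,
`binValF`, `coneSymF`, `vec3`, `vec3Equiv`, `nZ`, `coneSum`, `vecM`, `vecMEquiv`, `crt3`, `liftZ`,
`coneSymZ`, `wD`, `DPartProp`, `wN`, `ellZ`, `bZ`.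

## References

* T. Shintani, *On construction of holomorphic cusp forms of half integral weight*, Nagoya Math. J.
  58 (1975) 83–126, §1.6 (Prop. 1.6: the Weil representation on `L*/L` and theta transformation
  formulae), Thm. 2. [Shintani1975]
* W. Kohnen, *Fourier coefficients of modular forms of half-integral weight*, Math. Ann. 271 (1985)
  237–268, §1–2 (the genus character `ω_D` in theta kernels).
-/

noncomputable section

open Complex Finset

namespace Literature.NumberTheory.EllipticCurves.Shintani

open Literature.NumberTheory.EllipticCurves.ModularForms (quadGaussSum quadGaussSum_def
  sum_sq_eq_sum_card_mul quadGaussSum_prime_eq_quadraticChar_mul)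

section FiniteField

variable {p : ℕ} [hp : Fact p.Prime]

/-- The quadratic character of `𝔽_p`, complex-valued. [folklore] -/
abbrev χc (p : ℕ) [Fact p.Prime] : MulChar (ZMod p) ℂ :=
  (quadraticChar (ZMod p)).ringHomComp (Int.castRingHom ℂ)

/-- `χc_apply` (auxiliary). [folklore] -/
theorem χc_apply (a : ZMod p) : χc p a = ((quadraticChar (ZMod p) a : ℤ) : ℂ) := by
  rw [χc, MulChar.ringHomComp_apply, eq_intCast]

/-- `ringChar_ne_two` (auxiliary). [folklore] -/
theorem ringChar_ne_two (hp2 : p ≠ 2) : ringChar (ZMod p) ≠ 2 := by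
  rwa [ZMod.ringChar_zmod_n]

/-- `χc_ne_one` (auxiliary). [folklore] -/
theorem χc_ne_one (hp2 : p ≠ 2) : χc p ≠ 1 :=
  (MulChar.ringHomComp_ne_one_iff (RingHom.injective_int _)).mpr
    (quadraticChar_ne_one (ringChar_ne_two hp2))

/-- `χc_isQuadratic` (auxiliary). [folklore] -/
theorem χc_isQuadratic : (χc p).IsQuadratic := (quadraticChar_isQuadratic (ZMod p)).comp _

/-- `χc_sq_eq_one` (auxiliary). [folklore] -/
theorem χc_sq_eq_one {a : ZMod p} (ha : a ≠ 0) : χc p (a ^ 2) = 1 := by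
  rw [χc_apply, quadraticChar_sq_one' ha]; simp

/-- `χc_mul_self_eq_one` (auxiliary). [folklore] -/
theorem χc_mul_self_eq_one {a : ZMod p} (ha : a ≠ 0) : χc p a * χc p a = 1 := by
  rw [← map_mul, ← sq, χc_sq_eq_one ha]

/-- The additive character `e_p(x) = exp(2πi x/p)`. [folklore] -/
abbrev ψp (p : ℕ) [NeZero p] : AddChar (ZMod p) ℂ := ZMod.stdAddChar

/-- The quadratic Gauss sum `g = ∑ χ(a) e(a/p)`. [folklore] -/
abbrev gq (p : ℕ) [Fact p.Prime] : ℂ := gaussSum (χc p) (ψp p)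

/-- **(F1)** `∑_λ χ(λ) e(λ c / p) = χ(c) · g` (for `c = 0` both sides vanish). [folklore] -/
theorem sum_χc_mul_ψ (hp2 : p ≠ 2) (c : ZMod p) :
    ∑ l : ZMod p, χc p l * ψp p (l * c) = χc p c * gq p := by
  by_cases hc : c = 0
  · rw [hc, MulChar.map_zero, zero_mul]
    simp_rw [mul_zero, AddChar.map_zero_eq_one, mul_one]
    exact MulChar.sum_eq_zero_of_ne_one (χc_ne_one hp2)
  · have hg := gaussSum_mulShift (χc p) (ψp p) (Units.mk0 c hc)
    rw [Units.val_mk0] at hg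
    have e : gaussSum (χc p) ((ψp p).mulShift c) = ∑ l : ZMod p, χc p l * ψp p (l * c) := by
      rw [gaussSum]
      refine Finset.sum_congr rfl fun l _ ↦ ?_
      rw [AddChar.mulShift_apply, mul_comm c l]
    rw [← e]
    -- `χ(c) g = χ(c) (χ(c) G_c) = G_c`
    calc gaussSum (χc p) ((ψp p).mulShift c)
        = (χc p c * χc p c) * gaussSum (χc p) ((ψp p).mulShift c) := by
          rw [χc_mul_self_eq_one hc, one_mul]
      _ = χc p c * gq p := by rw [mul_assoc, hg]

/-- Summing a function of `γ²`: `∑_γ f(γ²) = ∑_t (1 + χ(t)) f(t)`. [folklore] -/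
theorem sum_sq_eq_sum_one_add_χc (hp2 : p ≠ 2) (f : ZMod p → ℂ) :
    ∑ γ : ZMod p, f (γ ^ 2) = ∑ t : ZMod p, (1 + χc p t) * f t := by
  classical
  rw [sum_sq_eq_sum_card_mul f]
  refine Finset.sum_congr rfl fun t _ ↦ ?_
  congr 1
  have := quadraticChar_card_sqrts (ringChar_ne_two hp2) t
  rw [χc_apply]
  have h := congrArg (Int.cast : ℤ → ℂ) this
  push_cast at h
  rw [h, add_comm]

/-- `∑_t χ(t (t - e)) = -1` for `e ≠ 0` (a Jacobi sum). [folklore] -/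
theorem sum_χc_mul_sub (hp2 : p ≠ 2) {e : ZMod p} (he : e ≠ 0) :
    ∑ t : ZMod p, χc p (t * (t - e)) = -1 := by
  -- substitute `t = e s`
  have h1 : ∑ t : ZMod p, χc p (t * (t - e)) = ∑ s : ZMod p, χc p (s * (s - 1)) := by
    rw [← Equiv.sum_comp (Equiv.mulLeft₀ e he)]
    refine Finset.sum_congr rfl fun s _ ↦ ?_
    simp only [Equiv.mulLeft₀_apply]
    have : e * s * (e * s - e) = e ^ 2 * (s * (s - 1)) := by ring
    rw [this, map_mul, χc_sq_eq_one he, one_mul]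
  rw [h1]
  have hJ := jacobiSum_nontrivial_inv (χc_ne_one (p := p) hp2)
  rw [χc_isQuadratic.inv, jacobiSum] at hJ
  have h2 : ∑ s : ZMod p, χc p (s * (s - 1)) = χc p (-1) * ∑ s : ZMod p, χc p s * χc p (1 - s) := by
    rw [Finset.mul_sum]
    refine Finset.sum_congr rfl fun s _ ↦ ?_
    rw [← map_mul, ← map_mul]
    congr 1; ring
  rw [h2, hJ]
  have hm : χc p (-1) * χc p (-1) = 1 := χc_mul_self_eq_one (neg_ne_zero.mpr one_ne_zero)
  linear_combination -hm

/-- `∑_γ χ(γ² - e)` is `p - 1` for `e = 0` and `-1` for `e ≠ 0`. [folklore] -/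
theorem sum_χc_sq_sub (hp2 : p ≠ 2) (e : ZMod p) :
    ∑ γ : ZMod p, χc p (γ ^ 2 - e) = if e = 0 then (p : ℂ) - 1 else -1 := by
  rw [sum_sq_eq_sum_one_add_χc hp2 (fun t ↦ χc p (t - e))]
  simp_rw [add_mul, one_mul, Finset.sum_add_distrib]
  have h0 : ∑ t : ZMod p, χc p (t - e) = 0 := by
    rw [← Equiv.sum_comp (Equiv.addRight e)]
    simp only [Equiv.coe_addRight, add_sub_cancel_right]
    exact MulChar.sum_eq_zero_of_ne_one (χc_ne_one hp2)
  rw [h0, zero_add]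
  simp_rw [← map_mul]
  split_ifs with he
  · rw [he]
    simp_rw [sub_zero]
    have : ∀ t : ZMod p, χc p (t * t) = if t = 0 then 0 else 1 := by
      intro t
      split_ifs with ht
      · rw [ht, mul_zero, MulChar.map_zero]
      · exact χc_mul_self_eq_one ht ▸ (map_mul (χc p) t t)
    simp_rw [this]
    rw [Finset.sum_ite, Finset.sum_const_zero, zero_add, Finset.sum_const, nsmul_eq_mul, mul_one]
    rw [Finset.filter_ne', Finset.card_erase_of_mem (Finset.mem_univ _), Finset.card_univ,
      ZMod.card]
    have : 1 ≤ p := hp.out.one_lt.le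
    push_cast [Nat.cast_sub this]
    ring
  · exact sum_χc_mul_sub hp2 he

/-- **(F2)** The complete character sum of a quadratic polynomial (`A ≠ 0`):
`∑_β χ(Aβ² + Bβ + C) = (p-1) χ(A)` if `B² - 4AC = 0`, and `-χ(A)` otherwise. [folklore] -/
theorem sum_χc_quadratic (hp2 : p ≠ 2) {A : ZMod p} (hA : A ≠ 0) (B C : ZMod p) :
    ∑ β : ZMod p, χc p (A * β ^ 2 + B * β + C) =
      if B ^ 2 - 4 * A * C = 0 then ((p : ℂ) - 1) * χc p A else -χc p A := by
  have h2 : (2 : ZMod p) ≠ 0 := by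
    intro h
    have h2 : ((2 : ℕ) : ZMod p) = 0 := by exact_mod_cast h
    rw [ZMod.natCast_eq_zero_iff] at h2
    have := Nat.le_of_dvd two_pos h2
    have := hp.out.two_le
    omega
  have h4 : (4 : ZMod p) ≠ 0 := by
    have : (4 : ZMod p) = 2 * 2 := by norm_num
    rw [this]; exact mul_ne_zero h2 h2
  have h2A : 2 * A ≠ 0 := mul_ne_zero h2 hA
  set e : ZMod p := (B ^ 2 - 4 * A * C) / (4 * A ^ 2) with he
  -- complete the square and substitute `γ = β + B/(2A)`
  have hcs : ∀ β : ZMod p, A * β ^ 2 + B * β + C = A * ((β + B / (2 * A)) ^ 2 - e) := by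
    intro β
    rw [he]
    field_simp
    ring
  have h1 : ∑ β : ZMod p, χc p (A * β ^ 2 + B * β + C) =
      χc p A * ∑ γ : ZMod p, χc p (γ ^ 2 - e) := by
    rw [Finset.mul_sum]
    refine Fintype.sum_equiv (Equiv.addRight (B / (2 * A))) _ _ fun β ↦ ?_
    rw [Equiv.coe_addRight, hcs, map_mul]
  rw [h1, sum_χc_sq_sub hp2 e]
  have hiff : e = 0 ↔ B ^ 2 - 4 * A * C = 0 := by
    rw [he, div_eq_zero_iff]
    have : (4 : ZMod p) * A ^ 2 ≠ 0 := by
      have h4 : (4 : ZMod p) = 2 * 2 := by norm_num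
      rw [h4]; exact mul_ne_zero (mul_ne_zero h2 h2) (pow_ne_zero _ hA)
    simp [this]
  by_cases hd : B ^ 2 - 4 * A * C = 0
  · rw [if_pos hd, if_pos (hiff.mpr hd)]; ring
  · rw [if_neg hd, if_neg (mt hiff.mp hd)]; ring

/-! ### The cone symbol over `𝔽_p` and the sum over `P¹(𝔽_p)` -/

/-- Reduced discriminant `n(ρ) = 64ρ₁² - ρ₀ρ₂` over `𝔽_p`. [folklore] -/
def nF (ρ : Fin 3 → ZMod p) : ZMod p := 64 * ρ 1 ^ 2 - ρ 0 * ρ 2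

/-- Its polar form `B(ρ, μ) = 128ρ₁μ₁ - ρ₀μ₂ - ρ₂μ₀`. [folklore] -/
def bF (ρ μ : Fin 3 → ZMod p) : ZMod p := 128 * ρ 1 * μ 1 - ρ 0 * μ 2 - ρ 2 * μ 0

/-- Values of the binary form `[64μ₀, 128μ₁, μ₂]` over `𝔽_p`. [folklore] -/
def binValF (μ : Fin 3 → ZMod p) (s t : ZMod p) : ZMod p :=
  64 * μ 0 * s ^ 2 + 128 * μ 1 * s * t + μ 2 * t ^ 2

/-- `nF_add` (auxiliary). [folklore] -/
theorem nF_add (ρ μ : Fin 3 → ZMod p) : nF (ρ + μ) = nF ρ + bF ρ μ + nF μ := by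
  simp only [nF, bF, Pi.add_apply]; ring

/-- **The cone symbol over `𝔽_p`**: `0` off the cone `n = 0`, `χ(ρ₀)` (or `χ(ρ₂)` if `ρ₀ = 0`) on it;
`= χ(λ)` for the cone vector `[64ρ₀,128ρ₁,ρ₂] = λℓ²`. [folklore] -/
def coneSymF (ρ : Fin 3 → ZMod p) : ℂ :=
  if nF ρ = 0 then (if ρ 0 = 0 then χc p (ρ 2) else χc p (ρ 0)) else 0

/-- `coneSymF_of_ne` (auxiliary). [folklore] -/
theorem coneSymF_of_ne {ρ : Fin 3 → ZMod p} (h : nF ρ ≠ 0) : coneSymF ρ = 0 := by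
  simp [coneSymF, h]

/-- `coneSymF_neg` (auxiliary). [folklore] -/
theorem coneSymF_neg (ρ : Fin 3 → ZMod p) : coneSymF (-ρ) = χc p (-1) * coneSymF ρ := by
  unfold coneSymF
  have : nF (-ρ) = nF ρ := by simp only [nF, Pi.neg_apply]; ring
  rw [this]
  simp only [Pi.neg_apply, neg_eq_zero]
  split_ifs
  · rw [neg_eq_neg_one_mul, map_mul]
  · rw [neg_eq_neg_one_mul, map_mul]
  · rw [mul_zero]

/-- **(F3)** The sum of `χ` over the values of the form `k = [64μ₀,128μ₁,μ₂]` at the `p + 1` points of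
`P¹(𝔽_p)` (charts `(β : -1)` and `(1 : 0)`): `∑_β χ(k(β,-1)) + χ(k(1,0)) = p · Ω_p(μ)` — `0` for
nondegenerate `k`, `pχ(λ)` for `k = λℓ²`. [folklore] -/
theorem sum_χc_binValF (hp2 : p ≠ 2) (μ : Fin 3 → ZMod p) :
    ∑ β : ZMod p, χc p (binValF μ β (-1)) + χc p (binValF μ 1 0) = (p : ℂ) * coneSymF μ := by
  have h64 : (64 : ZMod p) ≠ 0 := by
    have h2 : (2 : ZMod p) ≠ 0 := by
      intro h
      have h2 : ((2 : ℕ) : ZMod p) = 0 := by exact_mod_cast h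
      rw [ZMod.natCast_eq_zero_iff] at h2
      have := Nat.le_of_dvd two_pos h2
      have := hp.out.two_le
      omega
    have : (64 : ZMod p) = 2 ^ 6 := by norm_num
    rw [this]; exact pow_ne_zero _ h2
  have hχ64 : χc p 64 = 1 := by
    have : (64 : ZMod p) = 8 ^ 2 := by norm_num
    rw [this]
    exact χc_sq_eq_one (by intro h8; apply h64; rw [this, h8]; ring)
  have e10 : binValF μ 1 0 = 64 * μ 0 := by simp only [binValF]; ring
  have eβ : ∀ β : ZMod p, binValF μ β (-1) = 64 * μ 0 * β ^ 2 + (-128 * μ 1) * β + μ 2 := by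
    intro β; simp only [binValF]; ring
  simp_rw [eβ, e10]
  unfold coneSymF
  by_cases h0 : μ 0 = 0
  · -- `μ₀ = 0`: the form is `-128μ₁ XY + μ₂ Y²`
    simp_rw [h0, mul_zero, zero_mul, zero_add, MulChar.map_zero, add_zero, if_true]
    by_cases h1 : μ 1 = 0
    · have hn : nF μ = 0 := by simp only [nF, h0, h1]; ring
      simp_rw [h1, mul_zero, zero_mul, zero_add, if_pos hn, Finset.sum_const, Finset.card_univ,
        ZMod.card, nsmul_eq_mul]
    · have hn : nF μ ≠ 0 := by
        simp only [nF, h0, zero_mul, sub_zero]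
        exact mul_ne_zero h64 (pow_ne_zero _ h1)
      rw [if_neg hn, mul_zero]
      have hc : (-128 : ZMod p) * μ 1 ≠ 0 := by
        refine mul_ne_zero ?_ h1
        have : (-128 : ZMod p) = -(2 * 64) := by norm_num
        rw [this, neg_ne_zero]
        exact mul_ne_zero (by
          intro h
          apply h64
          have : (64 : ZMod p) = 2 * 32 := by norm_num
          rw [this, h, zero_mul]) h64
      -- `β ↦ -128μ₁ β + μ₂` is a bijection
      have : ∑ β : ZMod p, χc p (-128 * μ 1 * β + μ 2) = ∑ x : ZMod p, χc p x := by
        refine Fintype.sum_equiv ((Equiv.mulLeft₀ _ hc).trans (Equiv.addRight (μ 2))) _ _ fun β ↦ ?_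
        simp
      rw [this]
      exact MulChar.sum_eq_zero_of_ne_one (χc_ne_one hp2)
  · -- `μ₀ ≠ 0`: apply (F2) with `A = 64μ₀`
    have hA : (64 : ZMod p) * μ 0 ≠ 0 := mul_ne_zero h64 h0
    rw [sum_χc_quadratic hp2 hA, if_neg h0]
    have hdisc : (-128 * μ 1) ^ 2 - 4 * (64 * μ 0) * μ 2 = 256 * nF μ := by
      simp only [nF]; ring
    have h256 : (256 : ZMod p) ≠ 0 := by
      have : (256 : ZMod p) = 64 * 4 := by norm_num
      rw [this]
      refine mul_ne_zero h64 ?_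
      intro h4; apply h64
      have : (64 : ZMod p) = 4 * 16 := by norm_num
      rw [this, h4, zero_mul]
    rw [hdisc, map_mul, hχ64, one_mul]
    by_cases hn : nF μ = 0
    · rw [if_pos (by rw [hn, mul_zero]), if_pos hn]; ring
    · rw [if_neg (mul_ne_zero h256 hn), if_neg hn]; ring

/-! ### (F4) Parametrising the cone: `∑_κ Ω_p(κ) F(κ) = ∑_{λ,β} χ(λ) F(λ/64, λβ/64, λβ²) + ∑_λ χ(λ) F(0,0,λ)` -/

/-- Coordinates on `𝔽_p³`. [folklore] -/
def vec3 (a b c : ZMod p) : Fin 3 → ZMod p := ![a, b, c]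

omit hp in
/-- `vec3_zero` (auxiliary). [folklore] -/
@[simp] theorem vec3_zero (a b c : ZMod p) : vec3 a b c 0 = a := rfl
omit hp in
/-- `vec3_one` (auxiliary). [folklore] -/
@[simp] theorem vec3_one (a b c : ZMod p) : vec3 a b c 1 = b := rfl
omit hp in
/-- `vec3_two` (auxiliary). [folklore] -/
@[simp] theorem vec3_two (a b c : ZMod p) : vec3 a b c 2 = c := rfl

/-- `𝔽_p × 𝔽_p × 𝔽_p ≃ 𝔽_p³`. [folklore] -/
def vec3Equiv : ZMod p × ZMod p × ZMod p ≃ (Fin 3 → ZMod p) where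
  toFun x := vec3 x.1 x.2.1 x.2.2
  invFun κ := (κ 0, κ 1, κ 2)
  left_inv x := by simp
  right_inv κ := by
    funext i; fin_cases i <;> rfl

/-- Triple-sum form of a sum over `𝔽_p³`. [folklore] -/
theorem sum_vec3 (G : (Fin 3 → ZMod p) → ℂ) :
    ∑ κ : Fin 3 → ZMod p, G κ = ∑ a : ZMod p, ∑ b : ZMod p, ∑ c : ZMod p, G (vec3 a b c) := by
  rw [← Equiv.sum_comp vec3Equiv, Fintype.sum_prod_type]
  refine Finset.sum_congr rfl fun a _ ↦ ?_
  rw [Fintype.sum_prod_type]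
  rfl

/-- **(F4)** Summing against the cone symbol: the nonzero cone vectors are
`(λ/64, λβ/64, λβ²)` (`λ ≠ 0`, `β ∈ 𝔽_p`: the forms `λ(X + βY)²`) and `(0, 0, λ)` (`λY²`), each once,
with symbol `χ(λ)`. [folklore] -/
theorem sum_coneSymF_mul (hp2 : p ≠ 2) (F : (Fin 3 → ZMod p) → ℂ) :
    ∑ κ : Fin 3 → ZMod p, coneSymF κ * F κ =
      ∑ l : ZMod p, ∑ β : ZMod p, χc p l * F (vec3 (l / 64) (l * β / 64) (l * β ^ 2)) +
        ∑ l : ZMod p, χc p l * F (vec3 0 0 l) := by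
  classical
  have h64 : (64 : ZMod p) ≠ 0 := by
    have h2 : (2 : ZMod p) ≠ 0 := by
      intro h
      have h2 : ((2 : ℕ) : ZMod p) = 0 := by exact_mod_cast h
      rw [ZMod.natCast_eq_zero_iff] at h2
      have := Nat.le_of_dvd two_pos h2
      have := hp.out.two_le
      omega
    have : (64 : ZMod p) = 2 ^ 6 := by norm_num
    rw [this]; exact pow_ne_zero _ h2
  have hχ64 : χc p 64 = 1 := by
    have : (64 : ZMod p) = 8 ^ 2 := by norm_num
    rw [this]
    exact χc_sq_eq_one (by intro h8; apply h64; rw [this, h8]; ring)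
  rw [sum_vec3]
  -- the slice `κ₀ = a`
  set T : ZMod p → ℂ := fun a ↦ ∑ b : ZMod p, ∑ c : ZMod p, coneSymF (vec3 a b c) * F (vec3 a b c)
    with hT
  change ∑ a : ZMod p, T a = _
  -- `T 0 = ∑_c χ(c) F(0,0,c)`
  have hT0 : T 0 = ∑ l : ZMod p, χc p l * F (vec3 0 0 l) := by
    rw [hT]
    dsimp only
    have inner : ∀ b : ZMod p, ∑ c : ZMod p, coneSymF (vec3 0 b c) * F (vec3 0 b c) =
        if b = 0 then ∑ c : ZMod p, χc p c * F (vec3 0 0 c) else 0 := by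
      intro b
      split_ifs with hb
      · rw [hb]
        refine Finset.sum_congr rfl fun c _ ↦ ?_
        unfold coneSymF
        have : nF (vec3 (0 : ZMod p) 0 c) = 0 := by simp [nF]
        rw [if_pos this]
        simp only [vec3_zero, vec3_two, if_true]
      · refine Finset.sum_eq_zero fun c _ ↦ ?_
        rw [coneSymF_of_ne, zero_mul]
        simp only [nF, vec3_zero, vec3_one, vec3_two, zero_mul, sub_zero]
        exact mul_ne_zero h64 (pow_ne_zero _ hb)
    simp_rw [inner]
    rw [Finset.sum_ite_eq' Finset.univ (0 : ZMod p), if_pos (Finset.mem_univ _)]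
  -- `T a = χ(a) ∑_b F(a, b, 64b²/a)` for `a ≠ 0`
  have hTa : ∀ a : ZMod p, a ≠ 0 →
      T a = χc p a * ∑ b : ZMod p, F (vec3 a b (64 * b ^ 2 / a)) := by
    intro a ha
    rw [hT]
    dsimp only
    rw [Finset.mul_sum]
    refine Finset.sum_congr rfl fun b _ ↦ ?_
    have inner : ∀ c : ZMod p, coneSymF (vec3 a b c) * F (vec3 a b c) =
        if c = 64 * b ^ 2 / a then χc p a * F (vec3 a b (64 * b ^ 2 / a)) else 0 := by
      intro c
      unfold coneSymF
      simp only [vec3_zero, vec3_two, if_neg ha]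
      have hiff : nF (vec3 a b c) = 0 ↔ c = 64 * b ^ 2 / a := by
        simp only [nF, vec3_zero, vec3_one, vec3_two]
        rw [eq_div_iff ha, sub_eq_zero]
        constructor
        · intro h; linear_combination -h
        · intro h; linear_combination -h
      by_cases hc : c = 64 * b ^ 2 / a
      · rw [if_pos (hiff.mpr hc), if_pos hc, hc]
      · rw [if_neg (mt hiff.mp hc), if_neg hc, zero_mul]
    simp_rw [inner]
    rw [Finset.sum_ite_eq' Finset.univ, if_pos (Finset.mem_univ _)]
  -- split off `a = 0`
  rw [Fintype.sum_eq_add_sum_compl (0 : ZMod p) T, hT0, add_comm]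
  congr 1
  -- `T' = T` off `0`, `T' 0 = 0`
  set T' : ZMod p → ℂ := fun a ↦ if a = 0 then 0 else T a with hT'
  have h1 : ∑ a ∈ ({0} : Finset (ZMod p))ᶜ, T a = ∑ a : ZMod p, T' a := by
    rw [Fintype.sum_eq_add_sum_compl (0 : ZMod p) T']
    have : T' 0 = 0 := by simp [hT']
    rw [this, zero_add]
    refine Finset.sum_congr rfl fun a ha ↦ ?_
    rw [Finset.mem_compl, Finset.mem_singleton] at ha
    simp [hT', ha]
  -- reparametrise `a = λ/64`
  have h2 : ∑ a : ZMod p, T' a = ∑ l : ZMod p, T' (l * 64⁻¹) :=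
    (Equiv.sum_comp (Equiv.mulRight₀ (64⁻¹ : ZMod p) (inv_ne_zero h64)) T').symm
  rw [h1, h2]
  refine Finset.sum_congr rfl fun l _ ↦ ?_
  by_cases hl : l = 0
  · simp [hT', hl]
  · have hl' : l * 64⁻¹ ≠ 0 := mul_ne_zero hl (inv_ne_zero h64)
    rw [hT']
    dsimp only
    rw [if_neg hl', hTa _ hl', Finset.mul_sum]
    -- `χ(λ/64) = χ(λ)` and `b = λβ/64`
    have hχ : χc p (l * 64⁻¹) = χc p l := by
      rw [map_mul]
      have : χc p (64⁻¹ : ZMod p) = 1 := by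
        have h := (map_mul (χc p) (64⁻¹ : ZMod p) 64).symm
        rw [inv_mul_cancel₀ h64, map_one, hχ64, mul_one] at h
        exact h
      rw [this, mul_one]
    rw [hχ]
    symm
    refine Fintype.sum_equiv (Equiv.mulLeft₀ (l * 64⁻¹) hl') _ _ fun β ↦ ?_
    simp only [Equiv.mulLeft₀_apply]
    congr 2
    funext i
    fin_cases i
    · show l / 64 = l * 64⁻¹
      rw [div_eq_mul_inv]
    · show l * β / 64 = l * 64⁻¹ * β
      rw [div_eq_mul_inv]; ring
    · show l * β ^ 2 = 64 * (l * 64⁻¹ * β) ^ 2 / (l * 64⁻¹)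
      field_simp

/-! ### (F5) The cone symbol is an eigenvector of the finite Fourier transform -/

/-- `bF_family_one` (auxiliary). [folklore] -/
theorem bF_family_one (l β : ZMod p) (μ : Fin 3 → ZMod p) (h64 : (64 : ZMod p) ≠ 0) :
    bF (vec3 (l / 64) (l * β / 64) (l * β ^ 2)) μ = l * (-(binValF μ β (-1)) / 64) := by
  simp only [bF, binValF, vec3_zero, vec3_one, vec3_two]
  field_simp
  ring

/-- `bF_family_two` (auxiliary). [folklore] -/
theorem bF_family_two (l : ZMod p) (μ : Fin 3 → ZMod p) :
    bF (vec3 0 0 l) μ = l * (-(μ 0)) := by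
  simp only [bF, vec3_zero, vec3_one, vec3_two]; ring

/-- **The cone Gauss sum at an odd prime** (`t ≠ 0`, `μ ∈ 𝔽_p³`):
`∑_{ρ ∈ 𝔽_p³} Ω_p(ρ - μ) e_p(t · n(ρ)) = Ω_p(-μ) · p · G(64t; p)`,
i.e. the cone symbol is an eigenvector of the Weil (finite Fourier) operator attached to `n`.
[folklore] -/
theorem sum_coneSymF_sub_mul_ψ (hp2 : p ≠ 2) {t : ZMod p} (ht : t ≠ 0) (μ : Fin 3 → ZMod p) :
    ∑ ρ : Fin 3 → ZMod p, coneSymF (ρ - μ) * ψp p (t * nF ρ) =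
      coneSymF (-μ) * p * quadGaussSum p (64 * t) 0 := by
  classical
  have h64 : (64 : ZMod p) ≠ 0 := by
    have h2 : (2 : ZMod p) ≠ 0 := by
      intro h
      have h2 : ((2 : ℕ) : ZMod p) = 0 := by exact_mod_cast h
      rw [ZMod.natCast_eq_zero_iff] at h2
      have := Nat.le_of_dvd two_pos h2
      have := hp.out.two_le
      omega
    have : (64 : ZMod p) = 2 ^ 6 := by norm_num
    rw [this]; exact pow_ne_zero _ h2
  have hχ64 : χc p 64 = 1 := by
    have : (64 : ZMod p) = 8 ^ 2 := by norm_num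
    rw [this]
    exact χc_sq_eq_one (by intro h8; apply h64; rw [this, h8]; ring)
  have hχ64i : χc p (64⁻¹ : ZMod p) = 1 := by
    have h := (map_mul (χc p) (64⁻¹ : ZMod p) 64).symm
    rw [inv_mul_cancel₀ h64, map_one, hχ64, mul_one] at h
    exact h
  -- Step 1–3: shift `ρ = κ + μ` and use `n(κ) = 0` on the support of `Ω_p`
  have step : ∑ ρ : Fin 3 → ZMod p, coneSymF (ρ - μ) * ψp p (t * nF ρ) =
      ψp p (t * nF μ) * ∑ κ : Fin 3 → ZMod p, coneSymF κ * ψp p (t * bF κ μ) := by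
    rw [Finset.mul_sum]
    symm
    refine Fintype.sum_equiv (Equiv.addRight μ) _ _ fun κ ↦ ?_
    rw [Equiv.coe_addRight, add_sub_cancel_right]
    by_cases hκ : nF κ = 0
    · rw [nF_add, hκ, zero_add, mul_add, AddChar.map_add_eq_mul]; ring
    · rw [coneSymF_of_ne hκ, zero_mul, mul_zero, zero_mul]
  rw [step, sum_coneSymF_mul hp2]
  -- the two families
  have fam1 : ∀ β : ZMod p,
      ∑ l : ZMod p, χc p l * ψp p (t * bF (vec3 (l / 64) (l * β / 64) (l * β ^ 2)) μ) =
        χc p (-t) * χc p (binValF μ β (-1)) * gq p := by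
    intro β
    have : ∀ l : ZMod p, t * bF (vec3 (l / 64) (l * β / 64) (l * β ^ 2)) μ =
        l * (-t * binValF μ β (-1) * 64⁻¹) := by
      intro l; rw [bF_family_one l β μ h64]; field_simp
    simp_rw [this]
    rw [sum_χc_mul_ψ hp2, map_mul, map_mul, hχ64i, mul_one]
  have fam2 : ∑ l : ZMod p, χc p l * ψp p (t * bF (vec3 0 0 l) μ) =
      χc p (-t) * χc p (binValF μ 1 0) * gq p := by
    have : ∀ l : ZMod p, t * bF (vec3 0 0 l) μ = l * (-t * μ 0) := by
      intro l; rw [bF_family_two]; ring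
    simp_rw [this]
    rw [sum_χc_mul_ψ hp2, map_mul]
    have e : binValF μ 1 0 = 64 * μ 0 := by simp only [binValF]; ring
    rw [e, map_mul, hχ64, one_mul]
  rw [Finset.sum_comm]
  simp_rw [fam1]
  rw [fam2, ← Finset.sum_mul, ← Finset.mul_sum]
  have key := sum_χc_binValF hp2 μ
  -- assemble: `ψ(t n(μ)) χ(-t) g (∑_β χ(V_β) + χ(V_∞)) = χ(-t) g p Ω(μ)` and the right-hand side
  have hrhs : coneSymF (-μ) * (p : ℂ) * quadGaussSum p (64 * t) 0 =
      χc p (-t) * gq p * (p * coneSymF μ) := by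
    rw [coneSymF_neg,
      show quadGaussSum p (64 * t) 0 = χc p (64 * t) * gq p from
        quadGaussSum_prime_eq_quadraticChar_mul hp2 (mul_ne_zero h64 ht),
      map_mul, hχ64, one_mul, show (-t : ZMod p) = -1 * t by ring, map_mul]
    ring
  rw [hrhs]
  by_cases hμ : coneSymF μ = 0
  · rw [hμ]
    have : ∑ β : ZMod p, χc p (binValF μ β (-1)) + χc p (binValF μ 1 0) = 0 := by
      rw [key, hμ, mul_zero]
    rw [show χc p (-t) * (∑ β : ZMod p, χc p (binValF μ β (-1))) * gq p +
        χc p (-t) * χc p (binValF μ 1 0) * gq p =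
        χc p (-t) * gq p * (∑ β : ZMod p, χc p (binValF μ β (-1)) + χc p (binValF μ 1 0)) by ring,
      this]
    ring
  · have hn : nF μ = 0 := by
      by_contra h; exact hμ (coneSymF_of_ne h)
    rw [hn, mul_zero, AddChar.map_zero_eq_one, one_mul]
    rw [show χc p (-t) * (∑ β : ZMod p, χc p (binValF μ β (-1))) * gq p +
        χc p (-t) * χc p (binValF μ 1 0) * gq p =
        χc p (-t) * gq p * (∑ β : ZMod p, χc p (binValF μ β (-1)) + χc p (binValF μ 1 0)) by ring,
      key]

end FiniteField

/-! ### Cone sums modulo a general `M`: definitions, the `2`-adic factor, multiplicativity -/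

section General

open Literature.NumberTheory.LFunctions (stdAddChar_eq_mul_of_coprime)

variable {M : ℕ} [NeZero M]

/-- `n(r) = 64r₁² - r₀r₂` on `(ℤ/M)³`. [folklore] -/
def nZ (r : Fin 3 → ZMod M) : ZMod M := 64 * r 1 ^ 2 - r 0 * r 2

/-- The weighted quadratic sum `∑_{r ∈ (ℤ/M)³} W(r) e_M(t · n(r))`. [folklore] -/
def coneSum (M : ℕ) [NeZero M] (W : (Fin 3 → ZMod M) → ℂ) (t : ZMod M) : ℂ :=
  ∑ r : Fin 3 → ZMod M, W r * ZMod.stdAddChar (t * nZ r)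

/-- Coordinates on `(ℤ/M)³`. [folklore] -/
def vecM (a b c : ZMod M) : Fin 3 → ZMod M := ![a, b, c]

omit [NeZero M] in
/-- `vecM_zero` (auxiliary). [folklore] -/
@[simp] theorem vecM_zero (a b c : ZMod M) : vecM a b c 0 = a := rfl
omit [NeZero M] in
/-- `vecM_one` (auxiliary). [folklore] -/
@[simp] theorem vecM_one (a b c : ZMod M) : vecM a b c 1 = b := rfl
omit [NeZero M] in
/-- `vecM_two` (auxiliary). [folklore] -/
@[simp] theorem vecM_two (a b c : ZMod M) : vecM a b c 2 = c := rfl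

omit [NeZero M] in
/-- `(ℤ/M)³` as a triple product. [folklore] -/
def vecMEquiv : ZMod M × ZMod M × ZMod M ≃ (Fin 3 → ZMod M) where
  toFun x := vecM x.1 x.2.1 x.2.2
  invFun κ := (κ 0, κ 1, κ 2)
  left_inv x := by simp
  right_inv κ := by funext i; fin_cases i <;> rfl

/-- Triple-sum form. [folklore] -/
theorem sum_vecM (G : (Fin 3 → ZMod M) → ℂ) :
    ∑ κ : Fin 3 → ZMod M, G κ = ∑ a : ZMod M, ∑ b : ZMod M, ∑ c : ZMod M, G (vecM a b c) := by
  rw [← Equiv.sum_comp vecMEquiv, Fintype.sum_prod_type]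
  refine Finset.sum_congr rfl fun a _ ↦ ?_
  rw [Fintype.sum_prod_type]
  rfl

/-- **The `2`-adic (and, generally, untwisted-in-`p`) factor**: for `4 ∣ M`, `t` a unit mod `M`,
and the weight `χ₋₄(r₂ - u₂)`:
`∑_{r ∈ (ℤ/M)³} χ₄(r₂ - u₂) e_M(t n(r)) = χ₄(-u₂) · M · G(64t; M)`
(the `r₀`-sum forces `r₂ = 0`; the `r₁`-sum is the Gauss sum). [folklore] -/
theorem coneSum_χ₄ (h4 : 4 ∣ M) {t : ZMod M} (ht : IsUnit t) (u₂ : ZMod M) :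
    coneSum M (fun r ↦ ((ZMod.χ₄ (ZMod.castHom h4 (ZMod 4) (r 2 - u₂)) : ℤ) : ℂ)) t =
      ((ZMod.χ₄ (ZMod.castHom h4 (ZMod 4) (-u₂)) : ℤ) : ℂ) * M * quadGaussSum M (64 * t) 0 := by
  classical
  rw [coneSum, sum_vecM]
  -- reorder: `c = r₂` outermost is not needed; compute the `a = r₀` sum innermost
  have inner : ∀ b c : ZMod M, ∑ a : ZMod M,
      ((ZMod.χ₄ (ZMod.castHom h4 (ZMod 4) (vecM a b c 2 - u₂)) : ℤ) : ℂ) *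
        ZMod.stdAddChar (t * nZ (vecM a b c)) =
      ((ZMod.χ₄ (ZMod.castHom h4 (ZMod 4) (c - u₂)) : ℤ) : ℂ) * ZMod.stdAddChar (t * (64 * b ^ 2)) *
        (if c = 0 then (M : ℂ) else 0) := by
    intro b c
    simp only [vecM_two]
    have : ∀ a : ZMod M, t * nZ (vecM a b c) = t * (64 * b ^ 2) + a * (-(t * c)) := by
      intro a; simp only [nZ, vecM_zero, vecM_one, vecM_two]; ring
    simp_rw [this, AddChar.map_add_eq_mul]
    rw [← Finset.mul_sum, ← Finset.mul_sum, AddChar.sum_mulShift _ (ZMod.isPrimitive_stdAddChar M),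
      ZMod.card, mul_assoc]
    congr 2
    by_cases hc : c = 0
    · simp [hc]
    · have : -(t * c) ≠ 0 := by
        rw [neg_ne_zero]
        exact (ht.mul_right_eq_zero).not.mpr hc
      simp [hc, this]
  -- bring the `a`-sum inside
  rw [Finset.sum_comm]
  have hbc : ∀ b : ZMod M, ∑ a : ZMod M, ∑ c : ZMod M,
      ((ZMod.χ₄ (ZMod.castHom h4 (ZMod 4) (vecM a b c 2 - u₂)) : ℤ) : ℂ) *
        ZMod.stdAddChar (t * nZ (vecM a b c)) =
      ZMod.stdAddChar (t * (64 * b ^ 2)) *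
        (((ZMod.χ₄ (ZMod.castHom h4 (ZMod 4) (-u₂)) : ℤ) : ℂ) * M) := by
    intro b
    rw [Finset.sum_comm]
    simp_rw [inner b, mul_ite, mul_zero]
    rw [Finset.sum_ite_eq' Finset.univ (0 : ZMod M), if_pos (Finset.mem_univ _), zero_sub]
    ring
  simp_rw [hbc]
  rw [← Finset.sum_mul, quadGaussSum_def]
  simp_rw [zero_mul, add_zero, show ∀ r : ZMod M, 64 * t * r ^ 2 = t * (64 * r ^ 2) from
    fun r ↦ by ring]
  ring


/-! #### Multiplicativity (Chinese remainder theorem) -/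

omit [NeZero M] in
/-- `n` commutes with ring homomorphisms. [folklore] -/
theorem map_nZ {M₁ : ℕ} (f : ZMod M →+* ZMod M₁) (r : Fin 3 → ZMod M) :
    f (nZ r) = nZ (fun i ↦ f (r i)) := by
  simp only [nZ, map_sub, map_mul, map_pow, map_ofNat]

/-- Coordinatewise Chinese remainder: `(ℤ/M₁M₂)³ ≃ (ℤ/M₁)³ × (ℤ/M₂)³`. [folklore] -/
def crt3 {M₁ M₂ : ℕ} (h : M₁.Coprime M₂) :
    (Fin 3 → ZMod (M₁ * M₂)) ≃ (Fin 3 → ZMod M₁) × (Fin 3 → ZMod M₂) where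
  toFun r := (fun i ↦ (ZMod.chineseRemainder h (r i)).1, fun i ↦ (ZMod.chineseRemainder h (r i)).2)
  invFun q := fun i ↦ (ZMod.chineseRemainder h).symm (q.1 i, q.2 i)
  left_inv r := by
    funext i
    simp
  right_inv q := by
    ext i <;> simp

/-- `crt3_fst` (auxiliary). [folklore] -/
theorem crt3_fst {M₁ M₂ : ℕ} (h : M₁.Coprime M₂) (r : Fin 3 → ZMod (M₁ * M₂)) (i : Fin 3) :
    (crt3 h r).1 i = ZMod.castHom (dvd_mul_right M₁ M₂) (ZMod M₁) (r i) :=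
  Prod.fst_zmod_cast (r i)

/-- `crt3_snd` (auxiliary). [folklore] -/
theorem crt3_snd {M₁ M₂ : ℕ} (h : M₁.Coprime M₂) (r : Fin 3 → ZMod (M₁ * M₂)) (i : Fin 3) :
    (crt3 h r).2 i = ZMod.castHom (dvd_mul_left M₂ M₁) (ZMod M₂) (r i) :=
  Prod.snd_zmod_cast (r i)

/-- **Multiplicativity of cone sums**: for coprime `M₁, M₂` and a product weight
`W(r) = W₁(r mod M₁) W₂(r mod M₂)`,
`coneSum (M₁M₂) W t = coneSum M₁ W₁ (M̄₂ t) · coneSum M₂ W₂ (M̄₁ t)` (`M̄₂ = M₂⁻¹ mod M₁`, etc.).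
[folklore] -/
theorem coneSum_mul_of_coprime {M₁ M₂ : ℕ} [NeZero M₁] [NeZero M₂] [NeZero (M₁ * M₂)]
    (h : M₁.Coprime M₂) (W₁ : (Fin 3 → ZMod M₁) → ℂ) (W₂ : (Fin 3 → ZMod M₂) → ℂ)
    (t : ZMod (M₁ * M₂)) :
    coneSum (M₁ * M₂) (fun r ↦ W₁ (fun i ↦ ZMod.castHom (dvd_mul_right M₁ M₂) (ZMod M₁) (r i)) *
        W₂ (fun i ↦ ZMod.castHom (dvd_mul_left M₂ M₁) (ZMod M₂) (r i))) t =
      coneSum M₁ W₁ ((M₂ : ZMod M₁)⁻¹ * ZMod.castHom (dvd_mul_right M₁ M₂) (ZMod M₁) t) *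
        coneSum M₂ W₂ ((M₁ : ZMod M₂)⁻¹ * ZMod.castHom (dvd_mul_left M₂ M₁) (ZMod M₂) t) := by
  classical
  rw [coneSum, coneSum, coneSum, Finset.sum_mul_sum, ← Fintype.sum_prod_type']
  refine Fintype.sum_equiv (crt3 h) _ _ fun r ↦ ?_
  have e1 : (crt3 h r).1 = fun i ↦ ZMod.castHom (dvd_mul_right M₁ M₂) (ZMod M₁) (r i) :=
    funext fun i ↦ crt3_fst h r i
  have e2 : (crt3 h r).2 = fun i ↦ ZMod.castHom (dvd_mul_left M₂ M₁) (ZMod M₂) (r i) :=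
    funext fun i ↦ crt3_snd h r i
  have h1 : ZMod.castHom (dvd_mul_right M₁ M₂) (ZMod M₁) (t * nZ r) =
      ZMod.castHom (dvd_mul_right M₁ M₂) (ZMod M₁) t *
        nZ (fun i ↦ ZMod.castHom (dvd_mul_right M₁ M₂) (ZMod M₁) (r i)) := by
    rw [map_mul, map_nZ]
  have h2 : ZMod.castHom (dvd_mul_left M₂ M₁) (ZMod M₂) (t * nZ r) =
      ZMod.castHom (dvd_mul_left M₂ M₁) (ZMod M₂) t *
        nZ (fun i ↦ ZMod.castHom (dvd_mul_left M₂ M₁) (ZMod M₂) (r i)) := by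
    rw [map_mul, map_nZ]
  rw [e1, e2, stdAddChar_eq_mul_of_coprime h (t * nZ r), h1, h2]
  ring_nf

end General

/-! ### (F8) The weights `ω` on residues and the `D`-part of the cone Gauss sum -/

section DPart

open Literature.NumberTheory.LFunctions (stdAddChar_eq_mul_of_coprime)
open Literature.NumberTheory.EllipticCurves.ModularForms (quadGaussSum_mul_of_coprime
  quadGaussSum_unit_sq_mul quadGaussSum_eq_one_of_eq_one)

/-- Integer lift of a residue vector. [folklore] -/
def liftZ {M : ℕ} (r : Fin 3 → ZMod M) : Fin 3 → ℤ := fun i ↦ ((r i).val : ℤ)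

/-- The cone symbol of a residue vector mod `p`. [folklore] -/
def coneSymZ (p : ℕ) (ρ : Fin 3 → ZMod p) : ℤ := coneSym p (liftZ ρ)

/-- **Bridge**: `Ω_p` of `𝔽_p³` (`coneSymF`, complex) is the integer cone symbol of the lift. [folklore] -/
theorem coneSymZ_eq_coneSymF {p : ℕ} [hp : Fact p.Prime] (ρ : Fin 3 → ZMod p) :
    (coneSymZ p ρ : ℂ) = coneSymF ρ := by
  unfold coneSymZ coneSym coneSymF liftZ
  have hcast : ∀ i, (((ρ i).val : ℕ) : ZMod p) = ρ i := fun i ↦ ZMod.natCast_zmod_val (ρ i)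
  have hcast' : ∀ i, (((ρ i).val : ℤ) : ZMod p) = ρ i := fun i ↦ by
    rw [Int.cast_natCast, hcast]
  have e1 : ((p : ℤ) ∣ nQ (fun i ↦ ((ρ i).val : ℤ))) ↔ nF ρ = 0 := by
    rw [← intCast_zmod_eq_zero_iff (p := p)]
    unfold nQ nF
    push_cast
    rw [hcast 0, hcast 1, hcast 2]
  have e2 : ((p : ℤ) ∣ ((ρ 0).val : ℤ)) ↔ ρ 0 = 0 := by
    rw [← intCast_zmod_eq_zero_iff (p := p), hcast' 0]
  by_cases hn : nF ρ = 0
  · rw [if_pos (e1.mpr hn), if_pos hn]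
    by_cases h0 : ρ 0 = 0
    · rw [if_pos (e2.mpr h0), if_pos h0, jacobiSym_eq_quadraticChar, χc_apply, hcast' 2]
    · rw [if_neg (mt e2.mp h0), if_neg h0, jacobiSym_eq_quadraticChar, χc_apply, hcast' 0]
  · rw [if_neg (mt e1.mp hn), if_neg hn, Int.cast_zero]

/-- The cone symbol of an integer vector is that of its residue. [folklore] -/
theorem coneSym_eq_coneSymZ (p : ℕ) [NeZero p] (v : Fin 3 → ℤ) :
    coneSym p v = coneSymZ p (fun i ↦ (v i : ZMod p)) := by
  unfold coneSymZ liftZ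
  refine coneSym_congr (M := p) (dvd_refl _) fun i ↦ ?_
  rw [Int.ModEq, ZMod.val_intCast, Int.emod_emod_of_dvd _ (dvd_refl _)]

/-- The cone symbol of a residue vector mod `M` (with `p ∣ M`) depends only on its image mod `p`. [folklore] -/
theorem coneSym_liftZ_eq {p M : ℕ} [NeZero M] [NeZero p] (r : Fin 3 → ZMod M) :
    coneSym p (liftZ r) = coneSymZ p (fun i ↦ ((r i).cast : ZMod p)) := by
  unfold coneSymZ liftZ
  refine coneSym_congr (M := p) (dvd_refl _) fun i ↦ ?_
  show ((r i).val : ℤ) ≡ ((((r i).cast : ZMod p)).val : ℤ) [ZMOD p]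
  rw [ZMod.cast_eq_val, ZMod.val_natCast, Int.ModEq]
  push_cast
  rw [Int.emod_emod_of_dvd _ (dvd_refl _)]

/-- **The odd part of the weight on residues**: `w_D(r) = ∏_{p ∣ D} Ω_p(r mod p)` for `r ∈ (ℤ/M)³`
(meaningful when `D ∣ M`). [folklore] -/
def wD (D : ℕ) {M : ℕ} (r : Fin 3 → ZMod M) : ℂ :=
  ((∏ p ∈ D.primeFactors, coneSymZ p (fun i ↦ ((r i).cast : ZMod p)) : ℤ) : ℂ)

/-- `w_D` is compatible with reduction: `w_D(r) = w_D(r mod M₁)` for `D ∣ M₁ ∣ M`. [folklore] -/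
theorem wD_castHom {D M M₁ : ℕ} [NeZero M] (hDM : D ∣ M₁) (h : M₁ ∣ M) (r : Fin 3 → ZMod M) :
    wD D r = wD D (fun i ↦ ZMod.castHom h (ZMod M₁) (r i)) := by
  haveI : NeZero M₁ := ⟨fun h0 ↦ by subst h0; exact NeZero.ne M (Nat.eq_zero_of_zero_dvd h)⟩
  unfold wD
  congr 1
  refine Finset.prod_congr rfl fun p hp ↦ ?_
  have hpD : p ∣ D := Nat.dvd_of_mem_primeFactors hp
  congr 1
  funext i
  show (ZMod.castHom (dvd_trans (dvd_trans hpD hDM) h) (ZMod p)) (r i) =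
    (ZMod.castHom (dvd_trans hpD hDM) (ZMod p)) ((ZMod.castHom h (ZMod M₁)) (r i))
  rw [← RingHom.comp_apply (ZMod.castHom (dvd_trans hpD hDM) (ZMod p)), ZMod.castHom_comp]

/-- **Multiplicativity of `w`**: `w_{ab}(r) = w_a(r mod a) w_b(r mod b)` for coprime `a, b`. [folklore] -/
theorem wD_mul {a b M : ℕ} (hab : a.Coprime b) (ha : a ≠ 0) (hb : b ≠ 0) (r : Fin 3 → ZMod M) :
    wD (a * b) r = wD a r * wD b r := by
  unfold wD
  rw [Nat.primeFactors_mul ha hb, Finset.prod_union hab.disjoint_primeFactors, Int.cast_mul]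

/-- For a prime `p`: `w_p(r) = Ω_p(r)`. [folklore] -/
theorem wD_prime {p : ℕ} [hp : Fact p.Prime] (r : Fin 3 → ZMod p) : wD p r = coneSymF r := by
  unfold wD
  rw [hp.out.primeFactors, Finset.prod_singleton, coneSymZ_eq_coneSymF]
  congr 1
  funext i
  exact ZMod.cast_id p (r i)

/-- `w_1 = 1`. [folklore] -/
theorem wD_one {M : ℕ} (r : Fin 3 → ZMod M) : wD 1 r = 1 := by
  simp [wD]

/-- The predicate proved by induction over square-free `D`. [folklore] -/
def DPartProp (D : ℕ) : Prop :=
  ∀ [NeZero D], Squarefree D → Odd D → ∀ (t : ZMod D), IsUnit t → ∀ u : Fin 3 → ZMod D,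
    coneSum D (fun r ↦ wD D (r - u)) t = wD D (-u) * D * quadGaussSum D (64 * t) 0

/-- `dPartProp_one` (auxiliary). [folklore] -/
theorem dPartProp_one : DPartProp 1 := by
  intro _ _ _ t _ u
  rw [wD_one, one_mul, coneSum, quadGaussSum_eq_one_of_eq_one rfl, Nat.cast_one, mul_one]
  have : ∀ r : Fin 3 → ZMod 1, wD 1 (r - u) * ZMod.stdAddChar (t * nZ r) = 1 := by
    intro r
    rw [wD_one, one_mul]
    have : t * nZ r = 0 := Subsingleton.elim _ _
    rw [this, AddChar.map_zero_eq_one]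
  simp_rw [this]
  rw [Finset.sum_const, Finset.card_univ, nsmul_eq_mul, mul_one]
  simp

/-- `dPartProp_prime` (auxiliary). [folklore] -/
theorem dPartProp_prime {p : ℕ} (hp : p.Prime) : DPartProp p := by
  intro _ _ hodd t ht u
  haveI := Fact.mk hp
  have hp2 : p ≠ 2 := by rintro rfl; exact (Nat.not_even_iff_odd.mpr hodd) even_two
  have ht0 : t ≠ 0 := ht.ne_zero
  rw [show (fun r : Fin 3 → ZMod p ↦ wD p (r - u)) = fun r ↦ coneSymF (r - u) from
    funext fun r ↦ wD_prime _, wD_prime, coneSum]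
  exact sum_coneSymF_sub_mul_ψ hp2 ht0 u

/-- `dPartProp_mul` (auxiliary). [folklore] -/
theorem dPartProp_mul {a b : ℕ} (h1a : 1 < a) (h1b : 1 < b) (hab : a.Coprime b)
    (ha : DPartProp a) (hb : DPartProp b) : DPartProp (a * b) := by
  intro _ hsq hodd t ht u
  haveI : NeZero a := ⟨by omega⟩
  haveI : NeZero b := ⟨by omega⟩
  have hsqa : Squarefree a := hsq.of_mul_left
  have hsqb : Squarefree b := hsq.of_mul_right
  have hodda : Odd a := (Nat.odd_mul.mp hodd).1
  have hoddb : Odd b := (Nat.odd_mul.mp hodd).2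
  set ua : Fin 3 → ZMod a := fun i ↦ ZMod.castHom (dvd_mul_right a b) (ZMod a) (u i) with hua'
  set ub : Fin 3 → ZMod b := fun i ↦ ZMod.castHom (dvd_mul_left b a) (ZMod b) (u i) with hub'
  set W₁ : (Fin 3 → ZMod a) → ℂ := fun ρ ↦ wD a (ρ - ua) with hW₁
  set W₂ : (Fin 3 → ZMod b) → ℂ := fun ρ ↦ wD b (ρ - ub) with hW₂
  -- split the weight
  have hW : (fun r : Fin 3 → ZMod (a * b) ↦ wD (a * b) (r - u)) = fun r ↦
      W₁ (fun i ↦ ZMod.castHom (dvd_mul_right a b) (ZMod a) (r i)) *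
      W₂ (fun i ↦ ZMod.castHom (dvd_mul_left b a) (ZMod b) (r i)) := by
    funext r
    rw [wD_mul hab (by omega) (by omega),
      wD_castHom (dvd_refl a) (dvd_mul_right a b), wD_castHom (dvd_refl b) (dvd_mul_left b a)]
    simp only [hW₁, hW₂, hua', hub', Pi.sub_apply, map_sub]
    rfl
  rw [hW, coneSum_mul_of_coprime hab W₁ W₂ t]
  -- the twists are units
  have hbu : IsUnit (b : ZMod a) := (ZMod.isUnit_iff_coprime b a).mpr hab.symm
  have hau : IsUnit (a : ZMod b) := (ZMod.isUnit_iff_coprime a b).mpr hab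
  have hbinv : IsUnit ((b : ZMod a)⁻¹) := IsUnit.of_mul_eq_one (b : ZMod a) (ZMod.inv_mul_of_unit _ hbu)
  have hainv : IsUnit ((a : ZMod b)⁻¹) := IsUnit.of_mul_eq_one (a : ZMod b) (ZMod.inv_mul_of_unit _ hau)
  have hta : IsUnit ((b : ZMod a)⁻¹ * ZMod.castHom (dvd_mul_right a b) (ZMod a) t) :=
    hbinv.mul (ht.map _)
  have htb : IsUnit ((a : ZMod b)⁻¹ * ZMod.castHom (dvd_mul_left b a) (ZMod b) t) :=
    hainv.mul (ht.map _)
  rw [show coneSum a W₁ _ = _ from ha hsqa hodda _ hta ua,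
    show coneSum b W₂ _ = _ from hb hsqb hoddb _ htb ub]
  -- right-hand side: weights
  have hw : wD (a * b) (-u) = wD a (-ua) * wD b (-ub) := by
    rw [wD_mul hab (by omega) (by omega),
      wD_castHom (dvd_refl a) (dvd_mul_right a b), wD_castHom (dvd_refl b) (dvd_mul_left b a)]
    simp only [hua', hub', Pi.neg_apply, map_neg]
    rfl
  -- right-hand side: Gauss sums
  have htval : t = ((t.val : ℕ) : ZMod (a * b)) := (ZMod.natCast_zmod_val t).symm
  have hG := quadGaussSum_mul_of_coprime hab (64 * t.val : ℤ)
  have e0 : ((64 * t.val : ℤ) : ZMod (a * b)) = 64 * t := by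
    push_cast; rw [ZMod.natCast_zmod_val]
  have ea : ((b * (64 * t.val) : ℤ) : ZMod a) =
      (b : ZMod a) ^ 2 * ((b : ZMod a)⁻¹ * ZMod.castHom (dvd_mul_right a b) (ZMod a) t) * 64 := by
    rw [ZMod.castHom_apply, ZMod.cast_eq_val, htval]
    rw [ZMod.val_natCast, Nat.mod_eq_of_lt (ZMod.val_lt t)]
    push_cast
    have : (b : ZMod a) * (b : ZMod a)⁻¹ = 1 := ZMod.mul_inv_of_unit _ hbu
    linear_combination (-(64 * (t.val : ZMod a) * (b : ZMod a))) * this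
  have eb : ((a * (64 * t.val) : ℤ) : ZMod b) =
      (a : ZMod b) ^ 2 * ((a : ZMod b)⁻¹ * ZMod.castHom (dvd_mul_left b a) (ZMod b) t) * 64 := by
    rw [ZMod.castHom_apply, ZMod.cast_eq_val, htval]
    rw [ZMod.val_natCast, Nat.mod_eq_of_lt (ZMod.val_lt t)]
    push_cast
    have : (a : ZMod b) * (a : ZMod b)⁻¹ = 1 := ZMod.mul_inv_of_unit _ hau
    linear_combination (-(64 * (t.val : ZMod b) * (a : ZMod b))) * this
  rw [e0, ea, eb, mul_assoc ((b : ZMod a) ^ 2), mul_assoc ((a : ZMod b) ^ 2),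
    quadGaussSum_unit_sq_mul hbu, quadGaussSum_unit_sq_mul hau] at hG
  rw [hw, hG, mul_comm (64 : ZMod a), mul_comm (64 : ZMod b)]
  push_cast
  ring


/-- **The `D`-part of the cone Gauss sum** (`D` odd square-free, `t` a unit mod `D`):
`∑_{r ∈ (ℤ/D)³} w_D(r - u) e_D(t n(r)) = w_D(-u) · D · G(64t; D)`, by induction over the prime
factorisation (prime case = the cone eigenvector lemma, multiplicativity by CRT). [folklore] -/
theorem dPartProp_all (D : ℕ) : DPartProp D := by
  induction D using Nat.recOnPosPrimePosCoprime with
  | prime_pow p n hp hn =>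
    rcases Nat.lt_or_ge 1 n with h2 | h2
    · -- square-free prime powers are primes
      intro _ hsq
      exfalso
      have hdvd : p * p ∣ p ^ n := by
        rw [← sq]; exact pow_dvd_pow p h2
      have := hsq p hdvd
      rw [Nat.isUnit_iff] at this
      exact hp.one_lt.ne' this
    · have hn1 : n = 1 := by omega
      subst hn1
      rw [pow_one]
      exact @dPartProp_prime p hp
  | zero => intro _ hsq; exact absurd hsq not_squarefree_zero
  | one => exact dPartProp_one
  | coprime a b ha hb hab iha ihb => exact dPartProp_mul ha hb hab iha ihb


/-! ### (F9) The full weight `ω_D` on residues modulo `N = 256 D` and the cone Gauss sum `(★G)` -/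

/-- **The weight on residues**: `ω_D(r) = χ₋₄(r₂ mod 4) · w_D(r)` for `r ∈ (ℤ/M)³`, `4 ∣ M`. [folklore] -/
def wN (D : ℕ) {M : ℕ} (h4 : 4 ∣ M) (r : Fin 3 → ZMod M) : ℂ :=
  ((ZMod.χ₄ (ZMod.castHom h4 (ZMod 4) (r 2)) : ℤ) : ℂ) * wD D r

/-- `256` is prime to every odd number. [folklore] -/
theorem coprime_256_of_odd {D : ℕ} (hD : Odd D) : Nat.Coprime 256 D := by
  have : Nat.Coprime 2 D := Nat.coprime_two_left.mpr hD
  simpa using Nat.Coprime.pow_left 8 this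

/-- **The cone Gauss sum `(★G)`** (`D` odd square-free, `N = 256 D`, `a` a unit mod `N`,
`u ∈ (ℤ/N)³`): `∑_{r ∈ (ℤ/N)³} ω_D(r - u) e_N(a · n(r)) = ω_D(-u) · N · G(64a; N)`. [folklore] -/
theorem coneSum_wN {D : ℕ} [NeZero D] (hsq : Squarefree D) (hodd : Odd D) (h4 : 4 ∣ 256 * D)
    (a : ZMod (256 * D)) (ha : IsUnit a) (u : Fin 3 → ZMod (256 * D)) :
    coneSum (256 * D) (fun r ↦ wN D h4 (r - u)) a =
      wN D h4 (-u) * (256 * D : ℕ) * quadGaussSum (256 * D) (64 * a) 0 := by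
  have hcop : Nat.Coprime 256 D := coprime_256_of_odd hodd
  haveI : NeZero (256 * D) := ⟨mul_ne_zero (by norm_num) (NeZero.ne D)⟩
  set π₁ := ZMod.castHom (dvd_mul_right 256 D) (ZMod 256) with hπ₁
  set π₂ := ZMod.castHom (dvd_mul_left D 256) (ZMod D) with hπ₂
  have h4' : (4 : ℕ) ∣ 256 := by norm_num
  set u₁ : Fin 3 → ZMod 256 := fun i ↦ π₁ (u i) with hu₁
  set u₂ : Fin 3 → ZMod D := fun i ↦ π₂ (u i) with hu₂
  set W₁ : (Fin 3 → ZMod 256) → ℂ := fun ρ ↦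
    ((ZMod.χ₄ (ZMod.castHom h4' (ZMod 4) (ρ 2 - u₁ 2)) : ℤ) : ℂ) with hW₁
  set W₂ : (Fin 3 → ZMod D) → ℂ := fun ρ ↦ wD D (ρ - u₂) with hW₂
  -- the `2`-adic character factors through `ℤ/256`
  have hχ : ∀ x : ZMod (256 * D), ZMod.castHom h4 (ZMod 4) x = ZMod.castHom h4' (ZMod 4) (π₁ x) := by
    intro x
    rw [hπ₁, ← RingHom.comp_apply (ZMod.castHom h4' (ZMod 4)), ZMod.castHom_comp]
  -- split the weight
  have hW : (fun r : Fin 3 → ZMod (256 * D) ↦ wN D h4 (r - u)) = fun r ↦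
      W₁ (fun i ↦ ZMod.castHom (dvd_mul_right 256 D) (ZMod 256) (r i)) *
      W₂ (fun i ↦ ZMod.castHom (dvd_mul_left D 256) (ZMod D) (r i)) := by
    funext r
    rw [wN, hχ, wD_castHom (dvd_refl D) (dvd_mul_left D 256)]
    simp only [hW₁, hW₂, hu₁, hu₂, Pi.sub_apply, map_sub]
    rfl
  rw [hW, coneSum_mul_of_coprime hcop W₁ W₂ a]
  -- units
  have hDu : IsUnit ((D : ℕ) : ZMod 256) := (ZMod.isUnit_iff_coprime D 256).mpr hcop.symm
  have h256u : IsUnit ((256 : ℕ) : ZMod D) := (ZMod.isUnit_iff_coprime 256 D).mpr hcop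
  have hDinv : IsUnit ((D : ZMod 256)⁻¹) := IsUnit.of_mul_eq_one (D : ZMod 256)
    (ZMod.inv_mul_of_unit _ hDu)
  have h256inv : IsUnit (((256 : ℕ) : ZMod D)⁻¹) := IsUnit.of_mul_eq_one ((256 : ℕ) : ZMod D)
    (ZMod.inv_mul_of_unit _ h256u)
  have ht₁ : IsUnit ((D : ZMod 256)⁻¹ * π₁ a) := hDinv.mul (ha.map _)
  have ht₂ : IsUnit ((((256 : ℕ) : ZMod D))⁻¹ * π₂ a) := h256inv.mul (ha.map _)
  -- the two local sums
  have hS₁ : coneSum 256 W₁ ((D : ZMod 256)⁻¹ * π₁ a) =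
      ((ZMod.χ₄ (ZMod.castHom h4' (ZMod 4) (-u₁ 2)) : ℤ) : ℂ) * 256 *
        quadGaussSum 256 (64 * ((D : ZMod 256)⁻¹ * π₁ a)) 0 := by
    have := coneSum_χ₄ (M := 256) h4' ht₁ (u₁ 2)
    rw [hW₁]
    exact_mod_cast this
  have hS₂ : coneSum D W₂ ((((256 : ℕ) : ZMod D))⁻¹ * π₂ a) =
      wD D (-u₂) * D * quadGaussSum D (64 * ((((256 : ℕ) : ZMod D))⁻¹ * π₂ a)) 0 :=
    dPartProp_all D hsq hodd _ ht₂ u₂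
  rw [show ((256 : ℕ) : ZMod D) = (256 : ZMod D) by push_cast; rfl] at hS₂
  rw [hS₁]
  erw [hS₂]
  -- right-hand side
  have hw : wN D h4 (-u) = ((ZMod.χ₄ (ZMod.castHom h4' (ZMod 4) (-u₁ 2)) : ℤ) : ℂ) * wD D (-u₂) := by
    rw [wN, hχ, wD_castHom (dvd_refl D) (dvd_mul_left D 256)]
    simp only [hu₁, hu₂, Pi.neg_apply, map_neg]
    rfl
  have hG := quadGaussSum_mul_of_coprime hcop (64 * a.val : ℤ)
  push_cast at hG
  have e0 : (64 : ZMod (256 * D)) * ((a.val : ℕ) : ZMod (256 * D)) = 64 * a := by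
    rw [ZMod.natCast_zmod_val]
  have hπ₁a : π₁ a = ((a.val : ℕ) : ZMod 256) := by rw [hπ₁, ZMod.castHom_apply, ZMod.cast_eq_val]
  have hπ₂a : π₂ a = ((a.val : ℕ) : ZMod D) := by rw [hπ₂, ZMod.castHom_apply, ZMod.cast_eq_val]
  have ea : (D : ZMod 256) * (64 * ((a.val : ℕ) : ZMod 256)) =
      (D : ZMod 256) ^ 2 * ((D : ZMod 256)⁻¹ * π₁ a) * 64 := by
    rw [hπ₁a]
    have : (D : ZMod 256) * (D : ZMod 256)⁻¹ = 1 := ZMod.mul_inv_of_unit _ hDu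
    linear_combination (-(64 * ((a.val : ℕ) : ZMod 256) * (D : ZMod 256))) * this
  have h256u' : IsUnit (256 : ZMod D) := by have := h256u; push_cast at this; exact this
  have eb : (256 : ZMod D) * (64 * ((a.val : ℕ) : ZMod D)) =
      (256 : ZMod D) ^ 2 * ((256 : ZMod D)⁻¹ * π₂ a) * 64 := by
    rw [hπ₂a]
    have : (256 : ZMod D) * (256 : ZMod D)⁻¹ = 1 := ZMod.mul_inv_of_unit _ h256u'
    linear_combination (-(64 * ((a.val : ℕ) : ZMod D) * (256 : ZMod D))) * this
  rw [e0, ea, eb, mul_assoc ((D : ZMod 256) ^ 2), mul_assoc ((256 : ZMod D) ^ 2),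
    quadGaussSum_unit_sq_mul hDu, quadGaussSum_unit_sq_mul h256u'] at hG
  rw [hw, hG, mul_comm (64 : ZMod 256), mul_comm (64 : ZMod D)]
  push_cast
  ring

/-- **Bridge to the integer weight**: for `4 ∣ M`, `D ∣ M`, the weight `genusWt D v` of
`ShintaniGenusSymbols` is `ω_D(v mod M)` (used with `M = 256 D` and `M = cD`). [folklore] -/
theorem genusWt_eq_wN {D M : ℕ} [NeZero M] (h4 : 4 ∣ M) (hDM : D ∣ M) (v : Fin 3 → ℤ) :
    (genusWt D v : ℂ) = wN D h4 (fun i ↦ (v i : ZMod M)) := by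
  unfold genusWt wN wD
  rw [Int.cast_mul]
  congr 1
  · have : ZMod.castHom h4 (ZMod 4) ((v 2 : ℤ) : ZMod M) = ((v 2 : ℤ) : ZMod 4) :=
      map_intCast _ _
    simp only [this]
  · congr 1
    refine Finset.prod_congr rfl fun p hp ↦ ?_
    haveI : NeZero p := ⟨(Nat.prime_of_mem_primeFactors hp).ne_zero⟩
    have hpM : p ∣ M := dvd_trans (Nat.dvd_of_mem_primeFactors hp) hDM
    rw [coneSym_eq_coneSymZ p v]
    congr 2
    funext i
    rw [ZMod.cast_intCast hpM]

/-! ### (F10) Evaluation of the Gauss coefficients at `c = 256` -/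

/-- The bilinear pairing `ℓ(r, k) = -r₀k₂ + r₁k₁ - r₂k₀` on `(ℤ/N)³ × ℤ³`. [folklore] -/
def ellZ {M : ℕ} (r : Fin 3 → ZMod M) (k : Fin 3 → ℤ) : ZMod M :=
  -(r 0 * (k 2 : ZMod M)) + r 1 * (k 1 : ZMod M) - r 2 * (k 0 : ZMod M)

/-- The polar form of `n` on `(ℤ/M)³`. [folklore] -/
def bZ {M : ℕ} (r u : Fin 3 → ZMod M) : ZMod M := 128 * r 1 * u 1 - r 0 * u 2 - r 2 * u 0

/-- `nZ_add` (auxiliary). [folklore] -/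
theorem nZ_add {M : ℕ} (r u : Fin 3 → ZMod M) : nZ (r + u) = nZ r + bZ r u + nZ u := by
  simp only [nZ, bZ, Pi.add_apply]; ring

/-- `w_D` does not see the coordinate `r₁` beyond `n`: shifting `r₁` by `2D` (`= N/128`, `N = 256D`)
changes neither `ω_D` nor `n (mod N)`. [folklore] -/
theorem wN_add_shift {D : ℕ} [NeZero D] (h4 : 4 ∣ 256 * D) (r : Fin 3 → ZMod (256 * D)) :
    wN D h4 (r + fun i ↦ if i = 1 then (2 * D : ZMod (256 * D)) else 0) = wN D h4 r := by
  unfold wN wD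
  congr 1
  · simp
  · congr 1
    refine Finset.prod_congr rfl fun p hp ↦ ?_
    have hpD : p ∣ D := Nat.dvd_of_mem_primeFactors hp
    congr 1
    funext i
    simp only [Pi.add_apply]
    split_ifs with hi
    · subst hi
      rw [ZMod.cast_add (dvd_mul_of_dvd_right hpD 256), show ((2 * D : ZMod (256 * D))).cast =
        (ZMod.castHom (dvd_mul_of_dvd_right hpD 256) (ZMod p)) (2 * D) from rfl, map_mul, map_natCast,
        (ZMod.natCast_eq_zero_iff D p).mpr hpD, mul_zero, add_zero]
    · rw [add_zero]

/-- `nZ_add_shift` (auxiliary). [folklore] -/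
theorem nZ_add_shift {D : ℕ} [NeZero D] (r : Fin 3 → ZMod (256 * D)) :
    nZ (r + fun i ↦ if i = 1 then (2 * D : ZMod (256 * D)) else 0) = nZ r := by
  simp only [nZ, Pi.add_apply, if_true, show (0 : Fin 3) ≠ 1 by decide, show (2 : Fin 3) ≠ 1 by decide,
    if_false, add_zero]
  have hN : ((256 * D : ℕ) : ZMod (256 * D)) = 0 := ZMod.natCast_self _
  push_cast at hN
  linear_combination (r 1 + D) * hN

/-- `ellZ_add_shift` (auxiliary). [folklore] -/
theorem ellZ_add_shift {D : ℕ} [NeZero D] (r : Fin 3 → ZMod (256 * D)) (k : Fin 3 → ℤ) :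
    ellZ (r + fun i ↦ if i = 1 then (2 * D : ZMod (256 * D)) else 0) k =
      ellZ r k + (2 * D : ZMod (256 * D)) * (k 1 : ZMod (256 * D)) := by
  simp only [ellZ, Pi.add_apply, if_true, show (0 : Fin 3) ≠ 1 by decide, show (2 : Fin 3) ≠ 1 by decide,
    if_false, add_zero]
  ring

/-- `ψ_{256D}(2D k₁) = 1` iff `128 ∣ k₁`. [folklore] -/
theorem stdAddChar_shift_ne_one {D : ℕ} [NeZero D] {k1 : ℤ} (hk : ¬ (128 : ℤ) ∣ k1) :
    (ZMod.stdAddChar ((2 * D * k1 : ℤ) : ZMod (256 * D)) : ℂ) ≠ 1 := by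
  intro h
  have h0 : ((2 * D * k1 : ℤ) : ZMod (256 * D)) = 0 := by
    have h' : (ZMod.stdAddChar ((2 * D * k1 : ℤ) : ZMod (256 * D)) : ℂ) =
        ZMod.stdAddChar (0 : ZMod (256 * D)) := by rw [h, AddChar.map_zero_eq_one]
    rw [ZMod.stdAddChar_apply, ZMod.stdAddChar_apply] at h'
    exact ZMod.injective_toCircle (Subtype.ext h')
  rw [ZMod.intCast_zmod_eq_zero_iff_dvd] at h0
  apply hk
  obtain ⟨m, hm⟩ := h0
  have hD : (D : ℤ) ≠ 0 := by exact_mod_cast NeZero.ne D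
  refine ⟨m, ?_⟩
  have : (2 * D : ℤ) * k1 = (2 * D : ℤ) * (128 * m) := by push_cast at hm; linear_combination hm
  exact mul_left_cancel₀ (mul_ne_zero two_ne_zero hD) this

/-! #### Scaling of the weights by integers -/

/-- `Ω_p(t v) = (t/p) Ω_p(v)` for a prime `p`. [folklore] -/
theorem coneSym_smul {p : ℕ} (hp : p.Prime) (t : ℤ) (v : Fin 3 → ℤ) :
    coneSym p (t • v) = jacobiSym t p * coneSym p v := by
  haveI := Fact.mk hp
  have hp' : Prime (p : ℤ) := Nat.prime_iff_prime_int.mp hp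
  unfold coneSym
  rw [nQ_smul]
  simp only [Pi.smul_apply, smul_eq_mul]
  by_cases ht : (p : ℤ) ∣ t
  · -- everything vanishes: `(t/p) = 0`
    have hJ : jacobiSym t p = 0 := jacobiSym_eq_zero_of_dvd ht
    rw [hJ, zero_mul]
    split_ifs with h1 h2
    · exact jacobiSym_eq_zero_of_dvd (dvd_mul_of_dvd_left ht _)
    · exact jacobiSym_eq_zero_of_dvd (dvd_mul_of_dvd_left ht _)
    · rfl
  · have e1 : ((p : ℤ) ∣ t ^ 2 * nQ v) ↔ (p : ℤ) ∣ nQ v := by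
      constructor
      · intro h
        rcases hp'.dvd_or_dvd h with h | h
        · exact absurd (hp'.dvd_of_dvd_pow h) ht
        · exact h
      · exact fun h ↦ dvd_mul_of_dvd_right h _
    have e2 : ((p : ℤ) ∣ t * v 0) ↔ (p : ℤ) ∣ v 0 := by
      constructor
      · intro h
        rcases hp'.dvd_or_dvd h with h | h
        · exact absurd h ht
        · exact h
      · exact fun h ↦ dvd_mul_of_dvd_right h _
    by_cases hn : (p : ℤ) ∣ nQ v
    · rw [if_pos (e1.mpr hn), if_pos hn]
      by_cases h0 : (p : ℤ) ∣ v 0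
      · rw [if_pos (e2.mpr h0), if_pos h0, jacobiSym.mul_left]
      · rw [if_neg (mt e2.mp h0), if_neg h0, jacobiSym.mul_left]
    · rw [if_neg (mt e1.mp hn), if_neg hn, mul_zero]

/-- `J(t | D) = ∏_{p ∣ D} J(t | p)` for square-free `D`. [folklore] -/
theorem jacobiSym_eq_prod_primeFactors {D : ℕ} (hD : Squarefree D) (t : ℤ) :
    jacobiSym t D = ∏ p ∈ D.primeFactors, jacobiSym t p := by
  conv_lhs => rw [← Nat.prod_primeFactors_of_squarefree hD]
  -- multiplicativity over a product of pairwise coprime (here distinct prime) factors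
  have key : ∀ s : Finset ℕ, (∀ p ∈ s, p ≠ 0) → jacobiSym t (∏ p ∈ s, p) = ∏ p ∈ s, jacobiSym t p := by
    intro s hs
    induction s using Finset.induction_on with
    | empty => simp [jacobiSym.one_right]
    | insert a s has ih =>
      rw [Finset.prod_insert has, Finset.prod_insert has]
      haveI : NeZero a := ⟨hs a (Finset.mem_insert_self a s)⟩
      haveI : NeZero (∏ p ∈ s, p) := ⟨Finset.prod_ne_zero_iff.mpr fun p hp ↦
        hs p (Finset.mem_insert_of_mem hp)⟩
      rw [jacobiSym.mul_right, ih fun p hp ↦ hs p (Finset.mem_insert_of_mem hp)]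
  exact key _ fun p hp ↦ (Nat.prime_of_mem_primeFactors hp).ne_zero

/-- **Scaling of the weight**: `ω_D(t v) = χ₄(t) J(t | D) ω_D(v)` (`D` square-free). [folklore] -/
theorem genusWt_smul {D : ℕ} (hD : Squarefree D) (t : ℤ) (v : Fin 3 → ℤ) :
    genusWt D (t • v) = ZMod.χ₄ t * jacobiSym t D * genusWt D v := by
  unfold genusWt
  rw [Finset.prod_congr rfl fun p hp ↦ coneSym_smul (Nat.prime_of_mem_primeFactors hp) t v,
    Finset.prod_mul_distrib, ← jacobiSym_eq_prod_primeFactors hD, Pi.smul_apply, smul_eq_mul,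
    Int.cast_mul, map_mul]
  ring

/-! #### (E1) Vanishing of the Gauss coefficient sum off `L` -/

/-- For `N = 256D` and `128 ∤ k₁`: `∑_{r mod N} ω_D(r) ψ_N(a n(r) + ℓ(r, k)) = 0`. [folklore] -/
theorem sum_wN_mul_stdAddChar_eq_zero {D : ℕ} [NeZero D] (h4 : 4 ∣ 256 * D) (a : ZMod (256 * D))
    (k : Fin 3 → ℤ) (hk : ¬ (128 : ℤ) ∣ k 1) :
    ∑ r : Fin 3 → ZMod (256 * D), wN D h4 r * ZMod.stdAddChar (a * nZ r + ellZ r k) = 0 := by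
  set sh : Fin 3 → ZMod (256 * D) := fun i ↦ if i = 1 then (2 * D : ZMod (256 * D)) else 0 with hsh
  set S := ∑ r : Fin 3 → ZMod (256 * D), wN D h4 r * ZMod.stdAddChar (a * nZ r + ellZ r k) with hS
  set F : (Fin 3 → ZMod (256 * D)) → ℂ := fun r ↦ wN D h4 r * ZMod.stdAddChar (a * nZ r + ellZ r k)
    with hF
  have hshift : S = ZMod.stdAddChar ((2 * D : ZMod (256 * D)) * (k 1 : ZMod (256 * D))) * S := by
    have h1 : S = ∑ r : Fin 3 → ZMod (256 * D), F (r + sh) :=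
      (Fintype.sum_equiv (Equiv.addRight sh) (fun r ↦ F (r + sh)) F (fun _ ↦ rfl)).symm
    conv_lhs => rw [h1]
    rw [hS, Finset.mul_sum]
    refine Finset.sum_congr rfl fun r _ ↦ ?_
    rw [hF]
    dsimp only
    rw [hsh, wN_add_shift, nZ_add_shift, ellZ_add_shift, ← add_assoc, AddChar.map_add_eq_mul]
    ring
  have hne : (ZMod.stdAddChar ((2 * D : ZMod (256 * D)) * (k 1 : ZMod (256 * D))) : ℂ) ≠ 1 := by
    have := stdAddChar_shift_ne_one (D := D) hk
    push_cast at this ⊢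
    exact this
  have : (1 - ZMod.stdAddChar ((2 * D : ZMod (256 * D)) * (k 1 : ZMod (256 * D)))) * S = 0 := by
    linear_combination hshift
  rcases mul_eq_zero.mp this with h | h
  · exact absurd (sub_eq_zero.mp h).symm hne
  · exact h

/-! #### (E2) The Gauss coefficient sum on `L`: completing the square -/

/-- `bZ_smul_right` (auxiliary). [folklore] -/
theorem bZ_smul_right {M : ℕ} (r u : Fin 3 → ZMod M) (t : ZMod M) : bZ r (t • u) = t * bZ r u := by
  simp only [bZ, Pi.smul_apply, smul_eq_mul]; ring

/-- `nZ_smul` (auxiliary). [folklore] -/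
theorem nZ_smul {M : ℕ} (t : ZMod M) (u : Fin 3 → ZMod M) : nZ (t • u) = t ^ 2 * nZ u := by
  simp only [nZ, Pi.smul_apply, smul_eq_mul]; ring

/-- **On `L` the Gauss coefficient sum is a cone Gauss sum** (`N = 256D`, `aa' = 1`):
`∑_r ω_D(r) ψ_N(a n(r) + B(r, u)) = ψ_N(-a' n(u)) · ω_D(-a'u) · N · G(64a; N)`. [folklore] -/
theorem sum_wN_mul_stdAddChar_bZ {D : ℕ} [NeZero D] (hsq : Squarefree D) (hodd : Odd D)
    (h4 : 4 ∣ 256 * D) (a a' : ZMod (256 * D)) (haa' : a * a' = 1) (u : Fin 3 → ZMod (256 * D)) :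
    ∑ r : Fin 3 → ZMod (256 * D), wN D h4 r * ZMod.stdAddChar (a * nZ r + bZ r u) =
      ZMod.stdAddChar (-(a' * nZ u)) * (wN D h4 (-(a' • u)) * (256 * D : ℕ) *
        quadGaussSum (256 * D) (64 * a) 0) := by
  have ha : IsUnit a := IsUnit.of_mul_eq_one a' haa'
  have key : ∀ r : Fin 3 → ZMod (256 * D),
      a * nZ r + bZ r u = a * nZ (r + a' • u) + -(a' * nZ u) := by
    intro r
    rw [nZ_add, bZ_smul_right, nZ_smul]
    linear_combination (-(bZ r u) - a' * nZ u) * haa'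
  simp_rw [key, AddChar.map_add_eq_mul]
  rw [← coneSum_wN hsq hodd h4 a ha (a' • u), coneSum, Finset.mul_sum]
  refine Fintype.sum_equiv (Equiv.addRight (a' • u)) _ _ fun r ↦ ?_
  simp only [Equiv.coe_addRight, add_sub_cancel_right]
  ring

end DPart

end Literature.NumberTheory.EllipticCurves.Shintani
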